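import Mathlib
import Summits.Ventures.PercRepro2.HCov

/-!
# The a₃-exploration fibres of the covariance form (HCOV) and the reduced statement (MEANS-a₃)
(blind cell PercRepro2, p5 g12; `proofs/P5-A3FIBRE.md`, S4 §2.4 (n))

Reveal the cluster `W₃ = C(a₃)`.  On `Q = {a₁ ↮ a₂}` the fibres `Q ∩ {C(a₃) = W}` (`fibre`) partition
`Q` (`sum_prob_fibre_inter`), and on each fibre the world of `a₃` is fixed: `s3 W = 1 / -1 / 0` as
`a₁ ∈ W / a₂ ∈ W / neither` (the fibres of `A` are `fibresA`).  The fibre sums `mW, Sb, Sub, So, Suo` are the masses of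
`1, σ_b, U_b, σ_o, U_o` on the fibre, `SF` the mass of `F = σ_o + σ₃ (γ − U_o)` with
`γ = D_o / D` (`gamma`).  **(MEANS-a₃)** (`A3Between`) is the (HCOV)-shaped inequality for the
conditional means given `W₃`:
`∑_W Sb·SF/m_W − (∑ Sb)(∑ SF)/P(Q) − ∑_{W ∈ A} Sub·Suo/m_W + (∑_A Sub)(∑_A Suo)/D ≥ 0`.
The paper theorem (P5-A3FIBRE §2): `Gc = D·P(Q)·(∑_W slack_W / m_W + btw)` with every fibre slack
`slack_W = m_W·S_{σ_bF} − Sb·SF − 1_A (m_W·S_{U_bU_o} − Sub·Suo) ≥ 0` by BHK06 Thm 1.4 (A-fibres)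
and Harris (T / T′-fibres) on `G − W`, so that `A3Between → HCov`; the fibre inequalities and the
assembly are the successor's Lean items (S4 §4).  This file holds the definitions and the partition
identity only.
-/

namespace Summit.Ventures.PercRepro2

open UnionCluster

namespace CovForm

namespace A3Fibre

section Defs

variable {V : Type*} {E : Type*} [Fintype V] [DecidableEq V] [Fintype E] [DecidableEq E]
  {R : Type*} [CommRing R]

/-- The fibre `Q ∩ {C(a₃) = W}` of the a₃-exploration, `Q = avoidAll ends a₂ {a₁} = {a₁ ↮ a₂}`. -/
def fibre (ends : E → Sym2 V) (a₁ a₂ a₃ : V) (W : Finset V) : Set (Config E) :=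
  avoidAll ends a₂ {a₁} ∩ clusterEvent ends a₃ (↑W : Set V)

/-- The world sign of `a₃` on the fibre `W`: `1` if `a₁ ∈ W`, `-1` if `a₂ ∈ W`, `0` otherwise. -/
def s3 (a₁ a₂ : V) (W : Finset V) : R :=
  if a₁ ∈ W then 1 else if a₂ ∈ W then -1 else 0

/-- Mass of the fibre `m_W = P(Q, C(a₃) = W)`. -/
noncomputable def mW (p : E → R) (ends : E → Sym2 V) (a₁ a₂ a₃ : V) (W : Finset V) : R :=
  prob p (fibre ends a₁ a₂ a₃ W)

/-- Mass of `σ_v` on the fibre: `P(fibre, v ∈ C₁) − P(fibre, v ∈ C₂)`. -/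
noncomputable def Ssig (p : E → R) (ends : E → Sym2 V) (a₁ a₂ a₃ v : V) (W : Finset V) : R :=
  prob p (fibre ends a₁ a₂ a₃ W ∩ connEvent ends a₁ v) -
    prob p (fibre ends a₁ a₂ a₃ W ∩ connEvent ends a₂ v)

/-- Mass of `U_v` on the fibre: `P(fibre, v ∈ C₁) + P(fibre, v ∈ C₂)` (disjoint on `Q`). -/
noncomputable def Su (p : E → R) (ends : E → Sym2 V) (a₁ a₂ a₃ v : V) (W : Finset V) : R :=
  prob p (fibre ends a₁ a₂ a₃ W ∩ connEvent ends a₁ v) +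
    prob p (fibre ends a₁ a₂ a₃ W ∩ connEvent ends a₂ v)

end Defs

section FieldDefs

variable {V : Type*} {E : Type*} [Fintype V] [DecidableEq V] [Fintype E] [DecidableEq E]
  {R : Type*} [Field R] [LinearOrder R]

/-- `γ = D_o / D = P(PD, o ∈ U) / P(PD)` (junk at `D = 0`, where `Gc = 0`). -/
noncomputable def gamma (p : E → R) (ends : E → Sym2 V) (o a₁ a₂ a₃ : V) : R :=
  Do p ends o a₁ a₂ a₃ / prob p (PDEvent ends a₁ a₂ a₃)

/-- Mass of `F = σ_o + σ₃ (γ − U_o)` on the fibre (`σ₃ = s3 W` is constant there). -/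
noncomputable def SF (p : E → R) (ends : E → Sym2 V) (o a₁ a₂ a₃ : V) (W : Finset V) : R :=
  Ssig p ends a₁ a₂ a₃ o W +
    s3 a₁ a₂ W * (gamma p ends o a₁ a₂ a₃ * mW p ends a₁ a₂ a₃ W - Su p ends a₁ a₂ a₃ o W)

/-- The fibres of the world `A = PD` (`a₃ ∉ U`): neither root is in `W`. -/
def fibresA (a₁ a₂ : V) : Finset (Finset V) :=
  Finset.univ.filter (fun W : Finset V => a₁ ∉ W ∧ a₂ ∉ W)

/-- **The means-level form** `btw` of (HCOV): `∑_W Sb·SF/m_W − (∑ Sb)(∑ SF)/P(Q) −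
∑_{W∈A} Sub·Suo/m_W + (∑_A Sub)(∑_A Suo)/D` (Lean's `x / 0 = 0` on empty fibres). -/
noncomputable def btw (p : E → R) (ends : E → Sym2 V) (o a₁ a₂ a₃ b : V) : R :=
  (∑ W : Finset V, Ssig p ends a₁ a₂ a₃ b W * SF p ends o a₁ a₂ a₃ W / mW p ends a₁ a₂ a₃ W) -
    (∑ W : Finset V, Ssig p ends a₁ a₂ a₃ b W) * (∑ W : Finset V, SF p ends o a₁ a₂ a₃ W) /
      prob p (avoidAll ends a₂ {a₁}) -
    (∑ W ∈ fibresA a₁ a₂, Su p ends a₁ a₂ a₃ b W * Su p ends a₁ a₂ a₃ o W / mW p ends a₁ a₂ a₃ W) +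
    (∑ W ∈ fibresA a₁ a₂, Su p ends a₁ a₂ a₃ b W) * (∑ W ∈ fibresA a₁ a₂, Su p ends a₁ a₂ a₃ o W) /
      prob p (PDEvent ends a₁ a₂ a₃)

/-- **(MEANS-a₃)**: the conditional means given `C(a₃)` satisfy the (HCOV)-shaped inequality
(census 0 / 2,832,480, P5-A3FIBRE §4). -/
def A3Between (p : E → R) (ends : E → Sym2 V) (o a₁ a₂ a₃ b : V) : Prop :=
  0 ≤ btw p ends o a₁ a₂ a₃ b

/-- The fibre slack `m_W·S_{σ_bF} − Sb·SF − 1_A (m_W·S_{U_bU_o} − Sub·Suo)`, with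
`S_{σ_bF} = S_{σ_bσ_o} + s3 (γ·Sb − S_{σ_bU_o})` and the masses spelled out as fibre
probabilities; the paper theorem says `0 ≤ slack W` for every `W` (BHK 1.4 / Harris on `G − W`). -/
noncomputable def slack (p : E → R) (ends : E → Sym2 V) (o a₁ a₂ a₃ b : V) (W : Finset V) : R :=
  let f := fibre ends a₁ a₂ a₃ W
  let Sbo := prob p (f ∩ (connEvent ends a₁ b ∩ connEvent ends a₁ o)) +
    prob p (f ∩ (connEvent ends a₂ b ∩ connEvent ends a₂ o)) -
    prob p (f ∩ (connEvent ends a₁ b ∩ connEvent ends a₂ o)) -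
    prob p (f ∩ (connEvent ends a₂ b ∩ connEvent ends a₁ o))
  let Sbuo := prob p (f ∩ (connEvent ends a₁ b ∩ connEvent ends a₁ o)) +
    prob p (f ∩ (connEvent ends a₁ b ∩ connEvent ends a₂ o)) -
    prob p (f ∩ (connEvent ends a₂ b ∩ connEvent ends a₁ o)) -
    prob p (f ∩ (connEvent ends a₂ b ∩ connEvent ends a₂ o))
  let Sbuo' := prob p (f ∩ (connEvent ends a₁ b ∩ connEvent ends a₁ o)) +
    prob p (f ∩ (connEvent ends a₁ b ∩ connEvent ends a₂ o)) +
    prob p (f ∩ (connEvent ends a₂ b ∩ connEvent ends a₁ o)) +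
    prob p (f ∩ (connEvent ends a₂ b ∩ connEvent ends a₂ o))
  let SbF := Sbo + s3 a₁ a₂ W * (gamma p ends o a₁ a₂ a₃ * Ssig p ends a₁ a₂ a₃ b W - Sbuo)
  mW p ends a₁ a₂ a₃ W * SbF - Ssig p ends a₁ a₂ a₃ b W * SF p ends o a₁ a₂ a₃ W -
    (if a₁ ∉ W ∧ a₂ ∉ W then
      mW p ends a₁ a₂ a₃ W * Sbuo' - Su p ends a₁ a₂ a₃ b W * Su p ends a₁ a₂ a₃ o W
    else 0)

end FieldDefs

section Partition

variable {V : Type*} {E : Type*} [Fintype V] [DecidableEq V] [Fintype E] [DecidableEq E]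
  {R : Type*} [CommRing R]

open Classical in
/-- The cluster of `a₃` as a `Finset`. -/
noncomputable def clusterFinset (ends : E → Sym2 V) (ω : Config E) (a₃ : V) : Finset V :=
  Finset.univ.filter (fun u => u ∈ cluster ends ω a₃)

omit [DecidableEq E] in
/-- The coercion of `clusterFinset` is the cluster. -/
lemma coe_clusterFinset (ends : E → Sym2 V) (ω : Config E) (a₃ : V) :
    (↑(clusterFinset ends ω a₃) : Set V) = cluster ends ω a₃ := by
  ext u
  simp [clusterFinset]

omit [DecidableEq E] in
/-- Exactly one fibre contains a given configuration. -/
lemma sum_indicator_clusterEvent (ends : E → Sym2 V) (a₃ : V) (ω : Config E) (x : R) :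
    ∑ W : Finset V, (clusterEvent ends a₃ (↑W : Set V)).indicator (fun _ => x) ω = x := by
  rw [Finset.sum_eq_single (clusterFinset ends ω a₃)]
  · rw [Set.indicator_of_mem]
    rw [mem_clusterEvent, coe_clusterFinset]
  · intro W _ hW
    rw [Set.indicator_of_notMem]
    rw [mem_clusterEvent]
    intro h
    apply hW
    apply Finset.coe_injective
    rw [coe_clusterFinset, h]
  · intro h
    exact absurd (Finset.mem_univ _) h

/-- **The fibres partition `Q`**: `∑_W P(Q ∩ {C(a₃) = W} ∩ X) = P(Q ∩ X)`. -/
theorem sum_prob_fibre_inter (p : E → R) (ends : E → Sym2 V) (a₁ a₂ a₃ : V)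
    (X : Set (Config E)) :
    ∑ W : Finset V, prob p (fibre ends a₁ a₂ a₃ W ∩ X) =
      prob p (avoidAll ends a₂ {a₁} ∩ X) := by
  unfold prob fibre
  rw [Finset.sum_comm]
  refine Finset.sum_congr rfl fun ω _ => ?_
  by_cases hQ : ω ∈ avoidAll ends a₂ {a₁} ∩ X
  · have key : ∀ W : Finset V,
        (avoidAll ends a₂ {a₁} ∩ clusterEvent ends a₃ (↑W : Set V) ∩ X).indicator (weight p) ω =
          (clusterEvent ends a₃ (↑W : Set V)).indicator (fun _ => weight p ω) ω := by
      intro W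
      by_cases hW : ω ∈ clusterEvent ends a₃ (↑W : Set V)
      · rw [Set.indicator_of_mem hW, Set.indicator_of_mem]
        exact ⟨⟨hQ.1, hW⟩, hQ.2⟩
      · rw [Set.indicator_of_notMem hW, Set.indicator_of_notMem]
        intro h; exact hW h.1.2
    simp_rw [key]
    rw [sum_indicator_clusterEvent, Set.indicator_of_mem hQ]
  · rw [Set.indicator_of_notMem hQ]
    refine Finset.sum_eq_zero fun W _ => ?_
    rw [Set.indicator_of_notMem]
    intro h; exact hQ ⟨h.1.1, h.2⟩

/-- The fibre masses sum to `P(Q)`. -/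
theorem sum_mW (p : E → R) (ends : E → Sym2 V) (a₁ a₂ a₃ : V) :
    ∑ W : Finset V, mW p ends a₁ a₂ a₃ W = prob p (avoidAll ends a₂ {a₁}) := by
  have h := sum_prob_fibre_inter p ends a₁ a₂ a₃ Set.univ
  simpa only [Set.inter_univ, mW] using h

end Partition

end A3Fibre

end CovForm

end Summit.Ventures.PercRepro2
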